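import Literature.NumberTheory.LFunctions.MatomakiRadziwillTaoTheorem17
import Literature.NumberTheory.LFunctions.MatomakiRadziwillTaoPropA3
import Literature.NumberTheory.LFunctions.MatomakiRadziwillTaoTheorem17OfKhale
import Literature.NumberTheory.LFunctions.MatomakiRadziwillTaoT2OfVK
import Literature.NumberTheory.LFunctions.VinogradovZetaSumEstimate
import HarnessLib

/-!
# Discharges for `TaoLogElliottTheorem23.lean`: Matomäki–Radziwiłł–Tao 2015, Theorem 1.7

Topic `Literature/NumberTheory/LFunctions`.  Everything in this file is PROVED; no definitions and no named
facts are introduced.  It is the proof file for the named fact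
`Literature.NumberTheory.LFunctions.MatomakiRadziwillTao2015_theorem17` of `TaoLogElliottTheorem23.lean`
(K. Matomäki, M. Radziwiłł, T. Tao, *An averaged form of Chowla's conjecture*, Algebra & Number Theory 9
(2015), Theorem 1.7: for `X ≥ H ≥ 10` and a `1`-bounded multiplicative `g`,
`sup_α ∫_0^X |∑_{x ≤ n ≤ x+H} g(n) e(αn)| dx ≪ (e^{-M(g;X,Q)/20} + log log H / log H + log^{-1/700} X) H X`,
`Q = min(log^{1/125} X, log⁵ H)`), which cannot live in that file itself (the proof imports
`MatomakiRadziwillTaoTheorem17.lean`, which imports `TaoLogElliottTheorem23.lean`).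

DISCHARGED (2026-08-15): `MatomakiRadziwillTao2015_theorem17_holds` below, UNCONDITIONALLY — the
Vinogradov–Korobov region `∃ c > 0, HasVKZeroFreeRegion c 21` proved in the tree
(`VKZeta.exists_hasVKZeroFreeRegion`, `VinogradovZetaSumEstimate.lean`) ⟹ Matomäki–Radziwiłł's Proposition 1 for
complex `f` on `𝒯₂` (`MRT2015.T2half_of_vk`) + the UNCONDITIONAL `L²` treatment of the window
`|t - t₁| ≤ (log X)^{1/16}` (`MRT2015.integral_sq_restrDirichlet_window_le_sq`: Gallagher's lemma and the window
form of the restricted Halász theorem, `HalaszRestrictedMultWindow.lean` / `HalaszRestrictedWindowSq.lean`)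
⟹ Proposition A.3 with middle term `K(1+M)²e^{-M}` (`MRT2015.propA3With_sq_of_T2half`) ⟹ Theorem A.2 ⟹ the
major arcs with `κ = 3` ⟹ Theorem 1.7 with the printed rate `e^{-M/20}` (`MRT2015.theorem17_of_propA3With_sq`).
The historical notes below describe the earlier frontier.

State of the proof in the tree (before the discharge).  The printed proof of Theorem 1.7 — Lemma 2.2, Theorem 2.3, Proposition 2.4,
the minor arcs of §3 and the major arcs of §4 — is proved in the tree down to the complex Matomäki–Radziwiłł
theorem of Appendix A (`MRT2015.MatomakiRadziwillTao2015_theorem17_of_theoremA2`,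
`MatomakiRadziwillTaoTheorem17.lean`), and Theorem A.2 is proved from Proposition A.3
(`MatomakiRadziwillTao2015_theoremA2_of_propA3`, `MatomakiRadziwillTaoPropA3.lean`).  Hence Theorem 1.7 rests
on the single named fact `Literature.NumberTheory.LFunctions.MatomakiRadziwillTao2015_propA3` (the mean value
theorem `∫_0^T |F(1+it)|² dt` for the `𝒮`-restricted Dirichlet polynomial of a complex `1`-bounded
multiplicative function), recorded below as the one-line composition
`MatomakiRadziwillTao2015_theorem17_of_propA3`; the discharge `MatomakiRadziwillTao2015_theorem17_holds` is the
term `MatomakiRadziwillTao2015_theorem17_of_propA3 MatomakiRadziwillTao2015_propA3_holds` as soon as the latter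
exists, and is to be appended here.  (The sibling files `TaoLogElliottProp24OfPropA3.lean`,
`TaoLogElliottTheorem23OfPropA3.lean`, `TaoLogChowlaOfTheoremA2.lean` record the same frontier for Tao 2016.)

On Proposition A.3 itself see the module docstrings of `MatomakiRadziwillTaoPropA3.lean` (§ "On the printed
proof"), `MatomakiRadziwillTaoSiftedDistance.lean` and `HalaszRestrictedOffMinimiser.lean` (the region
`𝒯₂ = {|t − t₁| ≥ (log X)^{1/16}}`), and note for the region `|t − t₁| ≤ (log X)^{1/16}`: Matomäki–Radziwiłł
2016 never bound the `𝒮`-restricted polynomial near the minimising twist — their Proposition 1 integrates over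
`[(log X)^{1/15}, T]` and the low frequencies are absorbed by the main term `(1/X) ∑_{X ≤ n ≤ 2X, n ∈ 𝒮} f(n)`
of their Theorem 3 (Lemma 14 with `h₂ = X/(log X)^{1/5}`, then Lemmas 4 and 5) — and Matomäki–Radziwiłł,
*Multiplicative functions in short intervals II* (arXiv:2007.04290), Remark after Theorem 9.2, keep the twisted
restricted main term `(1/X) ∑_{X < n ≤ 2X, n ∈ 𝒮} f(n) n^{-i t_f}`, bounding it only by
`2^J (M e^{-M/2} + (log X)^{-α})` ("In case `M(f;X)` tends to infinity but more slowly, it seems to be more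
complicated to show in general that the main term is small").  For Theorem 1.7 any bound `poly(M) e^{-cM}` with
`c > 5/6` in place of A.2's `(1 + M) e^{-M}` suffices in the major arcs of MRT §4 (there `W ≤ e^{M/3}` and the
`M`-term must be `≪ W^{-5/2}`); the square `((1 + M/2) e^{-M/2})²` of the tree's Halász bound for restricted
sums (`Halasz.Restricted.norm_restr_sum_le`, halved distance `M_½ ≥ M/2`) has `c = 1`.

## References
* K. Matomäki, M. Radziwiłł, T. Tao, *An averaged form of Chowla's conjecture*, Algebra & Number Theory 9
  (2015), 2167–2196; arXiv:1503.05121: Theorem 1.7; §2 ("Proof of Theorem 1.7 assuming Theorem 2.3");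
  Appendix A, Theorem A.2, Proposition A.3. [cite: MatomakiRadziwillTao2015, Theorem 1.7]
* K. Matomäki, M. Radziwiłł, *Multiplicative functions in short intervals*, Ann. of Math. 183 (2016),
  Theorem 3, Proposition 1, Lemmas 4, 5, 14. [cite: MatomakiRadziwillAnnals2016, Proposition 1]
* K. Matomäki, M. Radziwiłł, *Multiplicative functions in short intervals II*, arXiv:2007.04290, Theorem 9.2
  and the Remark following it. [cite: MatomakiRadziwill2020ShortIntervalsII, Theorem 9.2]
-/

namespace Literature.NumberTheory.LFunctions

/-- **Matomäki–Radziwiłł–Tao 2015, Theorem 1.7, from Proposition A.3.**  The named fact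
`MatomakiRadziwillTao2015_theorem17` follows from the single named fact `MatomakiRadziwillTao2015_propA3`:
Proposition A.3 ⟹ Theorem A.2 (`MatomakiRadziwillTao2015_theoremA2_of_propA3`, the Parseval step of
Appendix A) ⟹ Theorem 1.7 (`MRT2015.MatomakiRadziwillTao2015_theorem17_of_theoremA2`: Lemma 2.2, §§3–4,
Proposition 2.4, Theorem 2.3 and §2, all proved in the tree). [cite: MatomakiRadziwillTao2015, Theorem 1.7] -/
theorem MatomakiRadziwillTao2015_theorem17_of_propA3 (hA3 : MatomakiRadziwillTao2015_propA3) :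
    MatomakiRadziwillTao2015_theorem17 :=
  MRT2015.MatomakiRadziwillTao2015_theorem17_of_theoremA2 (MatomakiRadziwillTao2015_theoremA2_of_propA3 hA3)

/-- **Matomäki–Radziwiłł–Tao 2015, Theorem 1.7 as printed, from any Vinogradov–Korobov zero-free region**
`HasVKZeroFreeRegion cVK TVK` (`cVK > 0`): the `𝒯₂` bound `MRT2015.T2half_of_vk` and the unconditional `L²`
window give Proposition A.3 with middle term `K(1+M)²e^{-M}` (`MRT2015.propA3With_sq_of_T2half`), whence
Theorem 1.7 by `MRT2015.theorem17_of_propA3With_sq`. [cite: MatomakiRadziwillTao2015, Theorem 1.7] -/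
theorem MatomakiRadziwillTao2015_theorem17_of_vk {cVK TVK : ℝ} (hcVK : 0 < cVK)
    (hVK : HasVKZeroFreeRegion cVK TVK) : MatomakiRadziwillTao2015_theorem17 := by
  obtain ⟨K, hK0, hA3⟩ := MRT2015.propA3With_sq_of_T2half (MRT2015.T2half_of_vk hcVK hVK)
  exact MRT2015.theorem17_of_propA3With_sq (mid := fun M => K * (1 + M) ^ 2 * Real.exp (-M)) (K := K)
    (fun M _ => by positivity) (fun M _ => le_rfl) hA3

/-- **DISCHARGE of `MatomakiRadziwillTao2015_theorem17`** (Matomäki–Radziwiłł–Tao 2015, Theorem 1.7, as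
printed: `sup_α ∫_0^X |∑_{x ≤ n ≤ x+H} g(n) e(αn)| dx ≤ C (e^{-M(g;X,Q)/20} + log log H/log H + (log X)^{-1/700}) HX`
for `X ≥ H ≥ 10`, `1`-bounded multiplicative `g`): the Vinogradov–Korobov region proved in the tree
(`VKZeta.exists_hasVKZeroFreeRegion`) fed into `MatomakiRadziwillTao2015_theorem17_of_vk`.
[cite: MatomakiRadziwillTao2015, Theorem 1.7] -/
theorem MatomakiRadziwillTao2015_theorem17_holds : MatomakiRadziwillTao2015_theorem17 := by
  obtain ⟨c, hc, hVK⟩ := VKZeta.exists_hasVKZeroFreeRegion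
  exact MatomakiRadziwillTao2015_theorem17_of_vk hc hVK

end Literature.NumberTheory.LFunctions
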